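import Mathlib

/-!
# Hodge-locus census, V3-XT N = 1 — UNIT RIGIDITY for definite quaternion orders: the unit bookkeeping (U) of THEOREM-sketch DI-gen(ℓ) as a THEOREM (every `ℓ`, every tower, every order)

certified instances and evidence bearing on the general Hodge conjecture; no claim.

Setting (records `DERIVATION-DI-B.md` §0 (U), §3 (U) of the pub-hlocus cell; seat pub-hlocus-abs-2, engine B).  In THEOREM-sketch
DI-gen(ℓ) the automorphism groups `U_{a,m} = Aut_{W/𝔓^{m+1}}(E'_a) = T_{a,m}^×` of the towers `T_{a,m} = ℤ[ω_a] + ℓ^m O_i`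
(`O_i` a maximal order of the definite quaternion algebra `B_{ℓ,∞}`, `ℓ` an odd prime, `m ≥ 1`) enter the self-count (S), the pairwise
law (P) and the census (C) through `|U_{a,m}| ∈ {2,4,6}`; the derivation's step (U) asserts that reduction modulo `ℓ O_i` is INJECTIVE
on `U_{a,m}` ("`u ≠ 1` of finite order with `u - 1 ∈ ℓ O_i` is impossible for odd `ℓ`: `nrd(u-1) = 2 - trd u ∈ {1,2,3,4}` would be
divisible by `ℓ² ≥ 9`"), whence `U_{a,m}` is commutative (cyclic inside `𝔽_{ℓ²}^×`).  So far the tree certified these unit groups only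
case by case (`decide` anchors: `HodgeLocusCensusInertGeneralAnchors.towerUnits23/tower8`, `…Inert3CMColumnsAnchors`, …).
This file proves the structural statements ONCE, in coordinates `Fin 4 → ℚ` w.r.t. `1, i, j, k` of an arbitrary DEFINITE `(a,b)_ℚ`
(`a < 0`, `b < 0`; the census uses `(-1,-ℓ)`, `(-2,-ℓ)`, `(-q,-ℓ)`), for an arbitrary set `O` of vectors with INTEGRAL reduced
norms (every order qualifies; no basis, rank or maximality is used) and an arbitrary modulus `M ∈ ℤ`, `|M| ≥ 3`:
* `qmul`, `nrd`, `trd`, `one` — the product, reduced norm/trace and unit of `(a,b)_ℚ` in coordinates (same sign conventions as the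
  scale-4 integer product `qmul` of `HodgeLocusCensusInertGeneralAnchors`); `nrd_qmul` (multiplicativity), `qmul_assoc`,
  `qmul_self` (Cayley–Hamilton `x² = trd x·x - nrd x·1`), `nrd_nonneg` / `nrd_eq_zero_iff` (DEFINITENESS);
* `nrd_eq_one_of_unit` — a unit of `O` has reduced norm `1`;
* `unit_eq_one_of_sub_one_eq_smul` — **UNIT RIGIDITY**: a unit `u` of `O` with `u - 1 ∈ M·O`, `|M| ≥ 3`, equals `1`
  (`nrd u = 1 ⇒ u₀ ≥ -1 ⇒ nrd(u-1) = 2 - 2u₀ ≤ 4 < 9 ≤ M² ≤ M²·nrd β` unless `β = 0`); `|M| = 2` is genuinely excluded (`u = -1`);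
* `unit_eq_of_sub_eq_smul` — **INJECTIVITY** of reduction modulo `M·O` on the units of `O` (`O` closed under the product): for the
  census, `U_{a,m} → (O_i/ℓ O_i)^×` is injective for every odd prime `ℓ`, every `m ≥ 1`, every tower and every maximal order;
* `tower`, `tower_units_comm` — for `T = ℤ·1 + ℤ·c + λ·O` (the set `Rset O c λ` of `HodgeLocusCensusGrossLatticeTowerLemma`; with
  `c = ω_a`, `λ = ℓ^m` it is `T_{a,m}`) and `|λ| ≥ 3`, any two elements of `T` that are units of `O` COMMUTE — so every `U_{a,m}`,
  `m ≥ 1`, is abelian, with no appeal to `O_{D'}/ℓ ≅ 𝔽_{ℓ²}`;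
* `trd_of_unit`, `unit_shape` — a unit of a definite order (integral norms and traces) has `trd u ∈ {-2,…,2}` and is `1`, `-1`, or
  satisfies `u² = -1`, `u³ = -1` or `u³ = 1`; hence `U_{a,m}` (`m ≥ 1`) is a finite abelian group of exponent dividing `12`.
NOT formalised here (kept as recorded in the derivation / certified by the anchors and the kit census): the identification
`T_{a,m}/ℓ O_i ↪ O_{D'}/ℓ O_{D'} ≅ 𝔽_{ℓ²}` (saturation of the optimal embedding) and the consequent CYCLICITY bound `|U_{a,m}| ≤ 6`;
the values `|U_{a,m}|` tower by tower remain census data.  Nothing here is a statement about algebraic cycles.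
-/

set_option linter.dupNamespace false

namespace Summit.HodgeConjecture.HodgeConjecture.HodgeLocus.Census.UnitRigidity

/-- Coordinate vectors w.r.t. the basis `1, i, j, k` of `(a,b)_ℚ`. -/
abbrev Q4 := Fin 4 → ℚ

/-- The quaternion product of `(a,b)_ℚ` in coordinates (`i² = a`, `j² = b`, `k = ij = -ji`, `k² = -ab`, `ik = aj`, `kj = bi`). -/
def qmul (a b : ℚ) (x y : Q4) : Q4 :=
  ![x 0 * y 0 + a * x 1 * y 1 + b * x 2 * y 2 - a * b * x 3 * y 3,
    x 0 * y 1 + x 1 * y 0 - b * x 2 * y 3 + b * x 3 * y 2,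
    x 0 * y 2 + x 2 * y 0 + a * x 1 * y 3 - a * x 3 * y 1,
    x 0 * y 3 + x 3 * y 0 + x 1 * y 2 - x 2 * y 1]

/-- The unit quaternion `1`. -/
def one : Q4 := ![1, 0, 0, 0]

/-- Reduced norm `nrd x = x x̄ = x₀² - a x₁² - b x₂² + ab x₃²`. -/
def nrd (a b : ℚ) (x : Q4) : ℚ := x 0 ^ 2 - a * x 1 ^ 2 - b * x 2 ^ 2 + a * b * x 3 ^ 2

/-- Reduced trace `trd x = x + x̄ = 2x₀`. -/
def trd (x : Q4) : ℚ := 2 * x 0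

/-- `1` has real coordinate `1`. -/
@[simp] lemma one_apply_zero : one 0 = 1 := rfl
/-- `1` has `i`-coordinate `0`. -/
@[simp] lemma one_apply_one : one 1 = 0 := rfl
/-- `1` has `j`-coordinate `0`. -/
@[simp] lemma one_apply_two : one 2 = 0 := rfl
/-- `1` has `k`-coordinate `0`. -/
@[simp] lemma one_apply_three : one 3 = 0 := rfl
/-- Real coordinate of a product. -/
@[simp] lemma qmul_apply_zero (a b : ℚ) (x y : Q4) :
    qmul a b x y 0 = x 0 * y 0 + a * x 1 * y 1 + b * x 2 * y 2 - a * b * x 3 * y 3 := rfl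
/-- `i`-coordinate of a product. -/
@[simp] lemma qmul_apply_one (a b : ℚ) (x y : Q4) :
    qmul a b x y 1 = x 0 * y 1 + x 1 * y 0 - b * x 2 * y 3 + b * x 3 * y 2 := rfl
/-- `j`-coordinate of a product. -/
@[simp] lemma qmul_apply_two (a b : ℚ) (x y : Q4) :
    qmul a b x y 2 = x 0 * y 2 + x 2 * y 0 + a * x 1 * y 3 - a * x 3 * y 1 := rfl
/-- `k`-coordinate of a product. -/
@[simp] lemma qmul_apply_three (a b : ℚ) (x y : Q4) :
    qmul a b x y 3 = x 0 * y 3 + x 3 * y 0 + x 1 * y 2 - x 2 * y 1 := rfl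

/-- The product is associative. -/
theorem qmul_assoc (a b : ℚ) (x y z : Q4) : qmul a b (qmul a b x y) z = qmul a b x (qmul a b y z) := by
  ext i; fin_cases i <;> simp <;> ring

/-- `1` is a right unit. -/
theorem qmul_one (a b : ℚ) (x : Q4) : qmul a b x one = x := by
  ext i; fin_cases i <;> simp

/-- `1` is a left unit. -/
theorem one_qmul (a b : ℚ) (x : Q4) : qmul a b one x = x := by
  ext i; fin_cases i <;> simp

/-- Left distributivity over subtraction. -/
theorem qmul_sub (a b : ℚ) (x y z : Q4) : qmul a b x (y - z) = qmul a b x y - qmul a b x z := by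
  ext i; fin_cases i <;> simp <;> ring

/-- Right distributivity over subtraction. -/
theorem sub_qmul (a b : ℚ) (x y z : Q4) : qmul a b (x - y) z = qmul a b x z - qmul a b y z := by
  ext i; fin_cases i <;> simp <;> ring

/-- Left distributivity. -/
theorem qmul_add (a b : ℚ) (x y z : Q4) : qmul a b x (y + z) = qmul a b x y + qmul a b x z := by
  ext i; fin_cases i <;> simp <;> ring

/-- Right distributivity. -/
theorem add_qmul (a b : ℚ) (x y z : Q4) : qmul a b (x + y) z = qmul a b x z + qmul a b y z := by
  ext i; fin_cases i <;> simp <;> ring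

/-- Scalars pull out of the right factor. -/
theorem qmul_smul (a b : ℚ) (r : ℚ) (x y : Q4) : qmul a b x (r • y) = r • qmul a b x y := by
  ext i; fin_cases i <;> simp <;> ring

/-- Scalars pull out of the left factor. -/
theorem smul_qmul (a b : ℚ) (r : ℚ) (x y : Q4) : qmul a b (r • x) y = r • qmul a b x y := by
  ext i; fin_cases i <;> simp <;> ring

/-- Multiplicativity of the reduced norm (Euler's four-square identity for `(a,b)_ℚ`). -/
theorem nrd_qmul (a b : ℚ) (x y : Q4) : nrd a b (qmul a b x y) = nrd a b x * nrd a b y := by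
  simp [nrd]; ring

/-- `nrd 1 = 1`. -/
@[simp] theorem nrd_one (a b : ℚ) : nrd a b one = 1 := by simp [nrd]

/-- The reduced norm is quadratic: `nrd (r·x) = r²·nrd x`. -/
theorem nrd_smul (a b : ℚ) (r : ℚ) (x : Q4) : nrd a b (r • x) = r ^ 2 * nrd a b x := by
  simp [nrd]; ring

/-- `nrd (-x) = nrd x`. -/
theorem nrd_neg (a b : ℚ) (x : Q4) : nrd a b (-x) = nrd a b x := by
  simp [nrd]

/-- Polarisation against `1`: `nrd (x - 1) = nrd x - trd x + 1`. -/
theorem nrd_sub_one (a b : ℚ) (x : Q4) : nrd a b (x - one) = nrd a b x - trd x + 1 := by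
  simp [nrd, trd]; ring

/-- Cayley–Hamilton: `x² = trd(x)·x - nrd(x)·1`. -/
theorem qmul_self (a b : ℚ) (x : Q4) : qmul a b x x = trd x • x - nrd a b x • one := by
  ext i; fin_cases i <;> simp [nrd, trd] <;> ring

/-- DEFINITENESS: for `a < 0`, `b < 0` the reduced norm is a positive definite quadratic form. -/
theorem nrd_nonneg {a b : ℚ} (ha : a < 0) (hb : b < 0) (x : Q4) : 0 ≤ nrd a b x := by
  have h1 : 0 ≤ -a * x 1 ^ 2 := mul_nonneg (by linarith) (sq_nonneg _)
  have h2 : 0 ≤ -b * x 2 ^ 2 := mul_nonneg (by linarith) (sq_nonneg _)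
  have h3 : 0 ≤ a * b * x 3 ^ 2 := mul_nonneg (le_of_lt (mul_pos_of_neg_of_neg ha hb)) (sq_nonneg _)
  have h0 : 0 ≤ x 0 ^ 2 := sq_nonneg _
  simp only [nrd]; linarith

/-- DEFINITENESS, bis: `x₀² ≤ nrd x` (so a norm-one element has `|trd x| ≤ 2`). -/
theorem sq_le_nrd {a b : ℚ} (ha : a < 0) (hb : b < 0) (x : Q4) : x 0 ^ 2 ≤ nrd a b x := by
  have h1 : 0 ≤ -a * x 1 ^ 2 := mul_nonneg (by linarith) (sq_nonneg _)
  have h2 : 0 ≤ -b * x 2 ^ 2 := mul_nonneg (by linarith) (sq_nonneg _)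
  have h3 : 0 ≤ a * b * x 3 ^ 2 := mul_nonneg (le_of_lt (mul_pos_of_neg_of_neg ha hb)) (sq_nonneg _)
  simp only [nrd]; linarith

/-- DEFINITENESS, ter: `nrd x = 0 ↔ x = 0` (anisotropy of a definite norm form). -/
theorem nrd_eq_zero_iff {a b : ℚ} (ha : a < 0) (hb : b < 0) (x : Q4) : nrd a b x = 0 ↔ x = 0 := by
  constructor
  · intro h
    have h1 : 0 ≤ -a * x 1 ^ 2 := mul_nonneg (by linarith) (sq_nonneg _)
    have h2 : 0 ≤ -b * x 2 ^ 2 := mul_nonneg (by linarith) (sq_nonneg _)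
    have hab : 0 < a * b := mul_pos_of_neg_of_neg ha hb
    have h3 : 0 ≤ a * b * x 3 ^ 2 := mul_nonneg (le_of_lt hab) (sq_nonneg _)
    have h0 : 0 ≤ x 0 ^ 2 := sq_nonneg _
    simp only [nrd] at h
    have e0 : x 0 ^ 2 = 0 := by linarith
    have e1 : -a * x 1 ^ 2 = 0 := by linarith
    have e2 : -b * x 2 ^ 2 = 0 := by linarith
    have e3 : a * b * x 3 ^ 2 = 0 := by linarith
    have f0 : x 0 = 0 := by simpa using e0
    have f1 : x 1 = 0 := by
      rcases mul_eq_zero.mp e1 with h | h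
      · linarith
      · simpa using h
    have f2 : x 2 = 0 := by
      rcases mul_eq_zero.mp e2 with h | h
      · linarith
      · simpa using h
    have f3 : x 3 = 0 := by
      rcases mul_eq_zero.mp e3 with h | h
      · linarith
      · simpa using h
    ext i; fin_cases i <;> simp [f0, f1, f2, f3]
  · rintro rfl; simp [nrd]


/-- … and against `-1`: `nrd (x + 1) = nrd x + trd x + 1`. -/
theorem nrd_add_one (a b : ℚ) (x : Q4) : nrd a b (x + one) = nrd a b x + trd x + 1 := by
  simp [nrd, trd]; ring

/-! ## Units of a definite order

`O ⊆ (a,b)_ℚ` is any set whose elements have INTEGRAL reduced norm (every order qualifies); a unit of `O` is an element with a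
(one- or two-sided, as stated) inverse in `O`.  Nothing below uses a basis of `O`, its rank, or maximality. -/

/-- In a definite `(a,b)_ℚ` an element of `O` with a right inverse in `O` has reduced norm `1`
(`nrd u · nrd v = 1` with both factors non-negative integers). -/
theorem nrd_eq_one_of_unit {a b : ℚ} (ha : a < 0) (hb : b < 0) {O : Set Q4}
    (hO : ∀ x ∈ O, ∃ n : ℤ, nrd a b x = n) {u v : Q4} (hu : u ∈ O) (hv : v ∈ O)
    (huv : qmul a b u v = one) : nrd a b u = 1 := by
  obtain ⟨n, hn⟩ := hO u hu
  obtain ⟨n', hn'⟩ := hO v hv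
  have hprod : nrd a b u * nrd a b v = 1 := by rw [← nrd_qmul, huv, nrd_one]
  have h0 : (0 : ℚ) ≤ n := hn ▸ nrd_nonneg ha hb u
  have hzz : n * n' = 1 := by
    have : (n : ℚ) * n' = 1 := by rw [← hn, ← hn', hprod]
    exact_mod_cast this
  have hn1 : n = 1 := Int.eq_one_of_mul_eq_one_right (by exact_mod_cast h0) hzz
  rw [hn, hn1]; norm_num

/-- **UNIT RIGIDITY** (Minkowski–Serre type, for DEFINITE quaternion orders and EVERY modulus `|M| ≥ 3`): if `u` is a unit of `O`
and `u ≡ 1 (mod M·O)`, then `u = 1`.  Proof: `nrd u = 1` forces `u₀ ≥ -1`, so `nrd(u - 1) = 2 - trd u ≤ 4`; but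
`nrd(u - 1) = M²·nrd β` with `nrd β` a non-negative integer and `M² ≥ 9`, so `nrd β = 0`, `β = 0`.  (For `M = ℓ^m`, `ℓ` an odd
prime, `m ≥ 1`, this is the injectivity of `U_{a,m} = (ℤ[ω_a] + ℓ^m O_i)^× → (O_i/ℓ^m O_i)^×` used in (U) of DI-gen(ℓ); `|M| = 2` is
genuinely excluded: `u = -1 ≡ 1 (mod 2O)`.) -/
theorem unit_eq_one_of_sub_one_eq_smul {a b : ℚ} (ha : a < 0) (hb : b < 0) {O : Set Q4}
    (hO : ∀ x ∈ O, ∃ n : ℤ, nrd a b x = n) {u v β : Q4} (hu : u ∈ O) (hv : v ∈ O) (hβ : β ∈ O)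
    (huv : qmul a b u v = one) {M : ℤ} (hM : 3 ≤ |M|) (h : u - one = (M : ℚ) • β) : u = one := by
  have hnu : nrd a b u = 1 := nrd_eq_one_of_unit ha hb hO hu hv huv
  have hsq : u 0 ^ 2 ≤ 1 := hnu ▸ sq_le_nrd ha hb u
  have hu0 : -1 ≤ u 0 := by nlinarith [hsq]
  have hle : nrd a b (u - one) ≤ 4 := by
    rw [nrd_sub_one, hnu]; simp only [trd]; linarith
  obtain ⟨k, hk⟩ := hO β hβ
  have hk0 : (0 : ℚ) ≤ k := hk ▸ nrd_nonneg ha hb β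
  have hM9 : (9 : ℚ) ≤ (M : ℚ) ^ 2 := by
    have h3 : (3 : ℚ) ≤ |(M : ℚ)| := by exact_mod_cast hM
    nlinarith [abs_nonneg (M : ℚ), sq_abs (M : ℚ)]
  have heq : nrd a b (u - one) = (M : ℚ) ^ 2 * k := by rw [h, nrd_smul, hk]
  have hk1 : (k : ℚ) < 1 := by nlinarith
  have hk' : k = 0 := by
    have h1 : k < 1 := by exact_mod_cast hk1
    have h2 : (0 : ℤ) ≤ k := by exact_mod_cast hk0
    omega
  have hβ0 : β = 0 := (nrd_eq_zero_iff ha hb β).mp (by rw [hk, hk']; simp)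
  have h0 : u - one = 0 := by rw [h, hβ0, smul_zero]
  exact sub_eq_zero.mp h0

/-- **INJECTIVITY OF REDUCTION ON UNITS**: two units `u, u'` of `O` (with `O` closed under the product) that are congruent modulo
`M·O`, `|M| ≥ 3`, are EQUAL — apply rigidity to the unit `v'u ≡ v'u' = 1`.  For the towers of DI-gen(ℓ): `U_{a,m} → O_i/ℓ O_i` is
injective for every `m ≥ 1` and every odd prime `ℓ` (take `M = ℓ`; `ℓ^m O_i ⊆ ℓ O_i`). -/
theorem unit_eq_of_sub_eq_smul {a b : ℚ} (ha : a < 0) (hb : b < 0) {O : Set Q4}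
    (hO : ∀ x ∈ O, ∃ n : ℤ, nrd a b x = n) (hOmul : ∀ x ∈ O, ∀ y ∈ O, qmul a b x y ∈ O)
    {u v u' v' β : Q4} (hu : u ∈ O) (hv : v ∈ O) (hu' : u' ∈ O) (hv' : v' ∈ O) (hβ : β ∈ O)
    (huv : qmul a b u v = one) (hu'v' : qmul a b u' v' = one) (hv'u' : qmul a b v' u' = one)
    {M : ℤ} (hM : 3 ≤ |M|) (h : u - u' = (M : ℚ) • β) : u = u' := by
  have hw : qmul a b v' u ∈ O := hOmul _ hv' _ hu
  have hwinv : qmul a b (qmul a b v' u) (qmul a b v u') = one := by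
    rw [qmul_assoc, ← qmul_assoc a b u, huv, one_qmul, hv'u']
  have hw1 : qmul a b v' u - one = (M : ℚ) • qmul a b v' β := by
    rw [← hv'u', ← qmul_sub, h, qmul_smul]
  have hwone : qmul a b v' u = one :=
    unit_eq_one_of_sub_one_eq_smul ha hb hO hw (hOmul _ hv _ hu') (hOmul _ hv' _ hβ) hwinv hM hw1
  calc u = qmul a b one u := (one_qmul a b u).symm
    _ = qmul a b (qmul a b u' v') u := by rw [hu'v']
    _ = qmul a b u' (qmul a b v' u) := qmul_assoc _ _ _ _ _
    _ = u' := by rw [hwone, qmul_one]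

/-! ## The towers `T = ℤ + ℤ·c + λ·O` and their unit groups -/

/-- Coordinate vectors of the `ℤ`-module `ℤ·1 + ℤ·c + λ·O` — literally the set `Rset O c lam` of
`HodgeLocusCensusGrossLatticeTowerLemma` (there `1 = ![1,0,0,0] = one`); for `c = ω_a` integral quadratic and `λ = ℓ^m` it is the
order `T_{a,m} = ℤ[ω_a] + ℓ^m O_i = End_{W/𝔓^{m+1}}(E'_a)` of DI-gen(ℓ), whose unit group is `U_{a,m}`. -/
def tower (O : Set Q4) (c : Q4) (lam : ℤ) : Set Q4 :=
  {v | ∃ (p q : ℤ) (β : Q4), β ∈ O ∧ v = (p : ℚ) • one + (q : ℚ) • c + (lam : ℚ) • β}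

/-- A tower lies inside `O` as soon as `O ∋ 1, c` is closed under sums and integer multiples. -/
theorem tower_subset {O : Set Q4} (hOadd : ∀ x ∈ O, ∀ y ∈ O, x + y ∈ O) (hOsmul : ∀ (n : ℤ), ∀ x ∈ O, (n : ℚ) • x ∈ O)
    (hone : one ∈ O) {c : Q4} (hc : c ∈ O) (lam : ℤ) : tower O c lam ⊆ O := by
  rintro v ⟨p, q, β, hβ, rfl⟩
  exact hOadd _ (hOadd _ (hOsmul p _ hone) _ (hOsmul q _ hc)) _ (hOsmul lam _ hβ)

/-- Elements of `ℤ·1 + ℤ·c` commute with each other (they are polynomials in `c`). -/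
theorem span_comm (a b : ℚ) (c : Q4) (p q p' q' : ℚ) :
    qmul a b (p • one + q • c) (p' • one + q' • c) = qmul a b (p' • one + q' • c) (p • one + q • c) := by
  ext i; fin_cases i <;> simp <;> ring

/-- **THE UNIT GROUP OF EVERY TOWER IS ABELIAN** (`|λ| ≥ 3`): if `u, u' ∈ T = ℤ + ℤc + λO` are units of `O` (two-sided inverses
`v, v'` in `O`), then `uu' = u'u`.  Indeed `u ≡ z`, `u' ≡ z'` (mod `λO`) with `z, z' ∈ ℤ + ℤc` commuting, so `uu' ≡ zz' = z'z ≡ u'u`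
(mod `λO`), and both sides are units of `O`: apply `unit_eq_of_sub_eq_smul`.  For DI-gen(ℓ): `U_{a,m}` is commutative for every
`m ≥ 1`, every odd `ℓ`, every tower and every maximal order — with NO appeal to `O_{D'}/ℓ = 𝔽_{ℓ²}`. -/
theorem tower_units_comm {a b : ℚ} (ha : a < 0) (hb : b < 0) {O : Set Q4}
    (hO : ∀ x ∈ O, ∃ n : ℤ, nrd a b x = n) (hOmul : ∀ x ∈ O, ∀ y ∈ O, qmul a b x y ∈ O)
    (hOadd : ∀ x ∈ O, ∀ y ∈ O, x + y ∈ O) (hOsub : ∀ x ∈ O, ∀ y ∈ O, x - y ∈ O)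
    (hOsmul : ∀ (n : ℤ), ∀ x ∈ O, (n : ℚ) • x ∈ O) (hone : one ∈ O) {c : Q4} (hc : c ∈ O)
    {lam : ℤ} (hlam : 3 ≤ |lam|) {u v u' v' : Q4}
    (hu : u ∈ tower O c lam) (hu' : u' ∈ tower O c lam) (hv : v ∈ O) (hv' : v' ∈ O)
    (huv : qmul a b u v = one) (hvu : qmul a b v u = one)
    (hu'v' : qmul a b u' v' = one) (hv'u' : qmul a b v' u' = one) :
    qmul a b u u' = qmul a b u' u := by
  have hsub := tower_subset hOadd hOsmul hone hc lam
  have huO : u ∈ O := hsub hu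
  have hu'O : u' ∈ O := hsub hu'
  obtain ⟨p, q, β, hβ, rfl⟩ := hu
  obtain ⟨p', q', β', hβ', rfl⟩ := hu'
  -- the commuting parts
  have hz : (p : ℚ) • one + (q : ℚ) • c ∈ O := hOadd _ (hOsmul p _ hone) _ (hOsmul q _ hc)
  have hz' : (p' : ℚ) • one + (q' : ℚ) • c ∈ O := hOadd _ (hOsmul p' _ hone) _ (hOsmul q' _ hc)
  have hzz := span_comm a b c (p : ℚ) q p' q'
  -- the correction term γ ∈ O with  uu' - u'u = (zz' - z'z) + λ·γ
  set z : Q4 := (p : ℚ) • one + (q : ℚ) • c with hzdef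
  set z' : Q4 := (p' : ℚ) • one + (q' : ℚ) • c with hz'def
  set γ : Q4 := qmul a b z β' + qmul a b β z' - qmul a b z' β - qmul a b β' z
      + (lam : ℚ) • (qmul a b β β' - qmul a b β' β) with hγdef
  have hγ : γ ∈ O := by
    refine hOadd _ (hOsub _ (hOsub _ (hOadd _ (hOmul _ hz _ hβ') _ (hOmul _ hβ _ hz')) _ (hOmul _ hz' _ hβ))
      _ (hOmul _ hβ' _ hz)) _ (hOsmul lam _ (hOsub _ (hOmul _ hβ _ hβ') _ (hOmul _ hβ' _ hβ)))
  have key : qmul a b (z + (lam : ℚ) • β) (z' + (lam : ℚ) • β') - qmul a b (z' + (lam : ℚ) • β') (z + (lam : ℚ) • β)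
      = (qmul a b z z' - qmul a b z' z) + (lam : ℚ) • γ := by
    simp only [hγdef, qmul_add, add_qmul, qmul_smul, smul_qmul, smul_sub, smul_add, smul_smul]
    abel_nf
  rw [hzz, sub_self, zero_add] at key
  -- both products are units of O
  have h1 : qmul a b (qmul a b (z + (lam : ℚ) • β) (z' + (lam : ℚ) • β')) (qmul a b v' v) = one := by
    rw [qmul_assoc, ← qmul_assoc a b (z' + (lam : ℚ) • β'), hu'v', one_qmul, huv]
  have h2 : qmul a b (qmul a b (z' + (lam : ℚ) • β') (z + (lam : ℚ) • β)) (qmul a b v v') = one := by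
    rw [qmul_assoc, ← qmul_assoc a b (z + (lam : ℚ) • β), huv, one_qmul, hu'v']
  have h3 : qmul a b (qmul a b v v') (qmul a b (z' + (lam : ℚ) • β') (z + (lam : ℚ) • β)) = one := by
    rw [qmul_assoc, ← qmul_assoc a b v', hv'u', one_qmul, hvu]
  exact unit_eq_of_sub_eq_smul ha hb hO hOmul (hOmul _ huO _ hu'O) (hOmul _ hv' _ hv) (hOmul _ hu'O _ huO)
    (hOmul _ hv _ hv') hγ h1 h2 h3 hlam key

/-! ## The shape of a unit: `±1` or of order `3, 4, 6` -/

/-- A unit of a definite order (integral norms AND traces) has `trd u ∈ {-2,-1,0,1,2}` (`u₀² ≤ nrd u = 1`). -/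
theorem trd_of_unit {a b : ℚ} (ha : a < 0) (hb : b < 0) {O : Set Q4}
    (hO : ∀ x ∈ O, ∃ n : ℤ, nrd a b x = n) (hOt : ∀ x ∈ O, ∃ t : ℤ, trd x = t) {u v : Q4} (hu : u ∈ O) (hv : v ∈ O)
    (huv : qmul a b u v = one) :
    trd u = -2 ∨ trd u = -1 ∨ trd u = 0 ∨ trd u = 1 ∨ trd u = 2 := by
  have hnu : nrd a b u = 1 := nrd_eq_one_of_unit ha hb hO hu hv huv
  have hsq : u 0 ^ 2 ≤ 1 := hnu ▸ sq_le_nrd ha hb u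
  obtain ⟨t, ht⟩ := hOt u hu
  have ht2 : (t : ℚ) ^ 2 ≤ 4 := by rw [← ht]; simp only [trd]; nlinarith
  have ht2' : t ^ 2 ≤ 4 := by exact_mod_cast ht2
  have htl : -2 ≤ t := by nlinarith
  have htu : t ≤ 2 := by nlinarith
  rw [ht]
  have : t = -2 ∨ t = -1 ∨ t = 0 ∨ t = 1 ∨ t = 2 := by omega
  rcases this with h | h | h | h | h <;> simp [h]

/-- **UNIT SHAPE**: every unit of a definite order is `1`, `-1`, or satisfies `u² = -1` (order 4), `u³ = -1` (order 6) or `u³ = 1`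
(order 3) — by Cayley–Hamilton `u² = trd(u)·u - 1` and definiteness.  With `tower_units_comm` this makes every `U_{a,m}` (`m ≥ 1`)
a finite ABELIAN group of exponent dividing `12`; the census anchors record its order (`2`, `4` or `6`) tower by tower. -/
theorem unit_shape {a b : ℚ} (ha : a < 0) (hb : b < 0) {O : Set Q4}
    (hO : ∀ x ∈ O, ∃ n : ℤ, nrd a b x = n) (hOt : ∀ x ∈ O, ∃ t : ℤ, trd x = t) {u v : Q4} (hu : u ∈ O) (hv : v ∈ O)
    (huv : qmul a b u v = one) :
    u = one ∨ u = -one ∨ qmul a b u u = -one ∨ qmul a b u (qmul a b u u) = -one ∨ qmul a b u (qmul a b u u) = one := by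
  have hnu : nrd a b u = 1 := nrd_eq_one_of_unit ha hb hO hu hv huv
  have hCH : qmul a b u u = trd u • u - one := by rw [qmul_self, hnu, one_smul]
  rcases trd_of_unit ha hb hO hOt hu hv huv with h | h | h | h | h
  · -- trd u = -2 : nrd (u + 1) = 0
    right; left
    have h0 : nrd a b (u + one) = 0 := by rw [nrd_add_one, hnu, h]; norm_num
    have := (nrd_eq_zero_iff ha hb _).mp h0
    exact eq_neg_of_add_eq_zero_left this
  · -- trd u = -1 : u² = -u - 1, u³ = 1
    right; right; right; right
    rw [hCH, h, qmul_sub, qmul_smul, hCH, h, qmul_one]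
    ext i; fin_cases i <;> simp
  · -- trd u = 0 : u² = -1
    right; right; left
    rw [hCH, h, zero_smul, zero_sub]
  · -- trd u = 1 : u² = u - 1, u³ = -1
    right; right; right; left
    rw [hCH, h, qmul_sub, qmul_smul, hCH, h, qmul_one]
    ext i; fin_cases i <;> simp
  · -- trd u = 2 : nrd (u - 1) = 0
    left
    have h0 : nrd a b (u - one) = 0 := by rw [nrd_sub_one, hnu, h]; norm_num
    have := (nrd_eq_zero_iff ha hb _).mp h0
    exact sub_eq_zero.mp this

end Summit.HodgeConjecture.HodgeConjecture.HodgeLocus.Census.UnitRigidity
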